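import Summits.HodgeConjecture.HodgeConjecture.Cruxes.BlochSeedDiscOne.SeedChecker
import Literature.AlgebraicGeometry.HodgeTheory.WeilCharacterDecomposition
import Literature.AlgebraicGeometry.HodgeTheory.WeilClassesProducts
import Literature.AlgebraicGeometry.HodgeTheory.ExpTwistClassesExponentialLaw
import Literature.AlgebraicGeometry.Motives.AbelianVarietyCohomologyExteriorH1

/-!
# `Cruxes/BlochSeedDiscOne/SeedCheckerDegree.lean` — SEED CHECKER v12 (§15): THE WEIL PLANE IS INVISIBLE TO THE `h`-DEGREE
# (`w ∪ h⁴ = 0` in `H¹⁶(S⁴)` for every Weil class `w` and every `K`-balanced `h` — in particular the stub's own `h_K = symH ψ e a`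
# for EVERY `(e, a)` and the frame's `h_std`), the C5 class pairs with `h⁴` to `q·h⁸`, the degree coordinate, and the degree-sign
# reading of C5 under NAMED orientation hypotheses

`line stmt-HodgeConjecture-18881 Cruxes/BlochSeedDiscOne/Lines/birth.lean 814a6a70c14e831a stub_rung_pad4_seedAt` · explicit unit
`hsemireg-c5c8-1` (g11; director MINT A5: C5–C8 typed as predicates on (design json, presentation)) · **a SATELLITE IN THE v4
NAMESPACE** `Summit.HodgeConjecture.HodgeConjecture.Cruxes.BlochSeedDiscOne.SeedChecker` — it imports ONLY `SeedChecker.lean` v4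
(`13437bb9848c3c36`, the built member of the family) plus four BUILT Literature modules (`WeilCharacterDecomposition`,
`WeilClassesProducts`, `ExpTwistClassesExponentialLaw`, `Motives.AbelianVarietyCohomologyExteriorH1`); it does NOT import the satellites
v5 `SeedCheckerPorteous`, v6.2 `SeedCheckerKit`, v7.1 `SeedCheckerFrame`, v8 `SeedCheckerBalanced`, v9 `SeedCheckerDescent`, v10
`SeedCheckerWords`, v11.1 `SeedCheckerOneAnchor` (farm snapshot: `lean check` rc 75 `unbuilt` at 2026-08-30T02:3xZ) and redeclares none
of their names (the diagonal character `bideg d p p` is v8's `balancedChar d p` by `rfl`, under a new name).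

## Honest framing (mandatory)

NOTHING in this file is proved toward HC ∕ HC_CM ∕ HC_AV ∕ №4 ∕ 26512 ∕ 18881 ∕ H2. It contains no `sorry`, constructs no bundle,
section, zero scheme, frame or seed, and touches no stub: `stub_rung_pad4_seedAt` is neither weakened nor specialised — only the
CLASS `symH ψ e a` named in its conclusion is studied, for arbitrary `(e, a)`. The seat produces evidence and typed files, not rungs.
The theorems of §15.1–§15.5 are UNCONDITIONAL linear algebra on the Betti carrier over the tree's `K`-character decomposition
(`iSup_pullbackEigenclasses_weilCharacter_eq_top`, `exists_pos_nat_separating_weilCharacters`, `cupProduct_mem_pullbackEigenclasses`,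
`b_{2g} = 1`); §15.6–§15.7 are doors whose positivity inputs (`∫_Z h⁴ > 0`, Hodge–Riemann on `W`) are NAMED HYPOTHESES, not proved.

## What v12 adds (all additive; no declaration of v4 is changed) — g10 §3 «the degree reading of `degreeSignAt` is PENCIL: no degree
## functional in v4» becomes a theorem package

§15.1 **TOP-DEGREE GRAM SHAPE of the `K`-character decomposition** (generic: `A` an abelian variety of dimension `2n`, `φ ≫ φ = -d`,
`d ≥ 1`). `pullbackEigenclasses_top_eq_top`: `H^{2g}(A(ℂ); ℂ) = χ_{g,g}` — every test isogeny acts on the top line by its degree.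
`eq_zero_of_mem_pullbackEigenclasses_top`: a top-degree eigenclass of a character ONE test pair separates from `χ_{g,g}` is `0`. Hence,
in `H⁴ⁿ`: **`W ∪ χ_{a,b} = χ_{a,b} ∪ W = 0` for every mixed summand** (`a + b = 2n`, `a, b ≥ 1`;
`cupProduct_eq_zero_of_mem_weilClassesOf_of_mem_mixed` and mirror), **`W ∪ W' = W' ∪ W = 0`** for the literal mixed span `W'` of the
tree's `weilClassesOf_sup_nonWeil_eq_top ∕ _inf_nonWeil_eq_bot` (`H²ⁿ = W ⊕ W'`), so the top pairing with a Weil class sees only the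
`W`-component (`exists_mem_weilClassesOf_cupProduct_eq`); in particular **`W ∪ χ_{n,n} = 0`** (`…_of_mem_bideg`); and **`E₊`, `E₋` are
ISOTROPIC** (`E₊ ∪ E₊ ⊆ χ_{4n,0} = 0`, `E₋ ∪ E₋ = 0`). One test isogeny `x₀·𝟙 + φ` per bidegree does the separating (`uᵃ ≠ ūᵃ`).
§15.2 **`d·c + ψ^*c ∈ χ_{1,1}` for every `c ∈ H²`** (`natCast_smul_add_map_mem_bideg`, fresh proof over the decomposition of `H²`);
so the stub's `h_K = symH ψ e a` is balanced for EVERY `(e, a)` (`symH_mem_bideg`, no compatibility with the frame, no hyperbolicity) and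
the frame's `h_std` is balanced (`hStd_mem_bideg`, via v4 `map_pad4Action_hStd`); `hᵖ ∈ χ_{p,p}` (`cupPowTwo_mem_bideg`).
§15.3 On the anchor `S⁴ = pad4Anchor E₀` (`n = 4`, `d = 1`): **`w ∪ h⁴ = 0` in `H¹⁶(S⁴(ℂ); ℂ)` for every Weil class `w` and every balanced
`h`** — `weil_cupProduct_symHPow_eq_zero` (the stub's `h_K`, every `(e, a)`), `weil_cupProduct_hStdPow_eq_zero`, `wOf_cupProduct_hPow_eq_zero`
(the frame classes `wOf μ`), `weilPlus∕Minus_cupProduct_…_eq_zero` (isotropy).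
§15.4 **THE C5 CLASS IN THE TOP PAIRING.** For `σ = q·h⁴ + wOf μ` (the class `ClassCheck K μ i q` asserts for `cl(Z)`):
`σ ∪ h⁴ = q·h⁸` (`classC5_cupProduct_hPow4`; instances `classCheckClass_cupProduct_symHPow4`, `classC5_cupProduct_hStdPow4`),
`σ ∪ w' = wOf μ ∪ w'` for Weil `w'` (`classC5_cupProduct_weil`), `σ ∪ σ' = (q q')·h⁸ + wOf μ ∪ wOf μ'` (`classC5_cupProduct_classC5`):
the pairing on the C5 lattice `ℚ·h⁴ ⊕ W_K` is BLOCK DIAGONAL — the `h`-block reads `q`, the `W`-block reads `μ`.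
§15.5 **THE DEGREE COORDINATE.** `finrank_top_pad4Anchor`: `dim H¹⁶(S⁴(ℂ); ℂ) = 1` (`b_{16} = 1`); for `h⁸ ≠ 0` (v8's
`cupPowTwo_symH_ne_zero' ∕ cupPowTwo_hStd_ne_zero`, Kähler volume — a hypothesis here) the coordinate `hDegree` = `deg_h` of the basis
`{h⁸}` (`Module.Basis.coord`), `deg_h h⁸ = 1`, `x = deg_h(x)·h⁸`; **`deg_h(σ ∪ h⁴) = q`** (`hDegree_classC5`), `deg_h(wOf μ ∪ h⁴) = 0`,
`deg_h(σ ∪ σ') = q q' + deg_h(wOf μ ∪ wOf μ')`; every linear functional on the top line is `δ(h⁸)·deg_h` (`linearForm_eq_mul_hDegree`).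
§15.6 **DEGREE SIGN (door).** `ratCoeff_pos_iff_hDegree_pos`: `0 < q ↔ 0 < Re deg_h(σ ∪ h⁴)` — normalisation-free; with an arbitrary
orientation functional `δ` real-positive on `h⁸` and on `σ ∪ h⁴`: `0 < q` (`ratCoeff_pos_of_oriented`), and `q ≤ 0 ⟹ Re δ(σ ∪ h⁴) ≤ 0`.
The one NAMED input left in v11's json screen `degreeSignAt D t` is «`deg_h(cl(Z) ∪ h⁴) > 0` for a non-empty pure-codimension-4 `Z`».
§15.7 **GRAM DETECTOR (C5 at the seed, numerical).** `gramDet` = `G_h(σ) = deg_h(σσ)·deg_h(h⁴h⁴) − deg_h(σh⁴)²`;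
**`G_h(q·h⁴ + wOf μ) = deg_h(wOf μ ∪ wOf μ)`** (`q` cancels), `= 0` at `μ = 0`; any orientation functional computes `δ(h⁸)²·G_h`
(`linearForm_gramDet`); under the NAMED Hodge–Riemann positivity of the Weil plane: **`μ ≠ 0 ↔ 0 < Re G_h(σ)`** and
**`μ ≠ 0 ↔ q² < Re deg_h(σ ∪ σ)`** — the design half of C5 read AT THE SEED from three intersection numbers (`Z·Z`, `Z·h⁴`, `h⁸`).

## C5–C8 flags added by v12 (cumulative table in the memo `SEED-CHECKER-C5C8-c5c8-1-g11.md` §3)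

* C5 degree sign: «`W ⟂ h⁴`» is now a THEOREM for the stub's own `h_K` (every `(e, a)`) and for `h_std`; the screen's only
  non-typed content is the positivity of `∫_Z h⁴` (and `h⁸ ≠ 0`, v8). * C5 design half (`μ ≠ 0`): INVISIBLE to every `h`-degree ∕
  Chern-number pairing with powers of `h` (`deg_h(wOf μ ∪ h⁴) = 0`) — NOT implied by any C0–C4-type numerology of `q`; visible in the
  `W`-block and, numerically, in the Gram determinant `G_h(cl Z)` under HR. * C8 (disc-one, `d = 1`): unchanged — per design vacuous (in
  the types); §15.1 records that `W ⊗ ℂ = E₊ ⊕ E₋` is a hyperbolic pair for the top pairing on EVERY Weil-type `2n`-fold (isotropy is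
  free; it does not distinguish `d`).

House rules kept: no `sorry` ∕ `axiom` ∕ `instance` ∕ `notation` ∕ `macro` ∕ attribute removal ∕ `native_decide` ∕
`allowUnsafeReducibility`; `noncomputable section` closed by the final `end`; cite tags only to keys of the family
(`vanGeemen1994HodgeAV`, `VoisinHodgeI2002`, `HatcherAT2002`). `lean check`: rc 0, 0 errors, 0 warnings, 0 sorries; `#print axioms` of the
main theorems ⊆ {propext, Classical.choice, Quot.sound}.
-/

noncomputable section

set_option linter.dupNamespace false

open CategoryTheory AlgebraicGeometry
open Literature.AlgebraicGeometry Literature.AlgebraicGeometry.Motives Literature.AlgebraicGeometry.HodgeTheory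
open Literature.AlgebraicTopology.SingularHomology

namespace Summit.HodgeConjecture.HodgeConjecture.Cruxes.BlochSeedDiscOne.SeedChecker

open Summit.HodgeConjecture.HodgeConjecture.Cruxes.BlochSeedDiscOne.Anchor
open Summit.Ventures.HSemireg Summit.Ventures.HSemireg.Pad4Tower

/-! ## §15.0 The bidegree characters `χ^d_{a,b}(x, y) = (x + iy√d)ᵃ (x − iy√d)ᵇ` -/

section Characters

/-- **the `K`-character of bidegree `(a, b)`**: `χ^d_{a,b}(x, y) = (x + iy√d)ᵃ·(x − iy√d)ᵇ`, the scalar by which the test pull-back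
`(x·𝟙 + y·ψ)^*` acts on the summand `⋀ᵃV₊ ⊗ ⋀ᵇV₋ ⊆ H^{a+b}(A(ℂ); ℂ)` (`ψ ≫ ψ = -d`), spelled LITERALLY as the summand of the tree's
`iSup_pullbackEigenclasses_weilCharacter_eq_top`. (`bideg d p p` is v8's `balancedChar d p` by `rfl`; v8 is not importable on the
current farm snapshot, so the diagonal case is re-spelled here under this name.) [cite: vanGeemen1994HodgeAV, 4.8–4.9] -/
def bideg (d a b : ℕ) : ℕ → ℕ → ℂ := fun x y =>
  ((x : ℂ) + (y : ℂ) * Complex.I * (Real.sqrt d : ℂ)) ^ a * ((x : ℂ) - (y : ℂ) * Complex.I * (Real.sqrt d : ℂ)) ^ b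

theorem bideg_apply (d a b x y : ℕ) : bideg d a b x y =
    ((x : ℂ) + (y : ℂ) * Complex.I * (Real.sqrt d : ℂ)) ^ a * ((x : ℂ) - (y : ℂ) * Complex.I * (Real.sqrt d : ℂ)) ^ b :=
  rfl

/-- characters multiply by adding bidegrees. -/
theorem bideg_mul (d a b a' b' x y : ℕ) :
    bideg d a b x y * bideg d a' b' x y = bideg d (a + a') (b + b') x y := by
  simp only [bideg_apply, pow_add]
  ring

variable {A : AbelianVariety ℂ} {φ : A ⟶ A}

/-- `E₊ ⊆ χ_{2n,0}` (the same subspace, literal respelling). -/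
theorem mem_bideg_of_mem_weilClassesPlus {n d : ℕ} {c : complexBetti A.X (2 * n)} (hc : c ∈ weilClassesPlus A φ n d) :
    c ∈ pullbackEigenclasses A φ (2 * n) (bideg d (2 * n) 0) := by
  rw [mem_pullbackEigenclasses_iff]
  intro x y
  rw [(mem_weilClassesPlus_iff.mp hc) x y, bideg_apply, pow_zero, mul_one]

/-- `E₋ ⊆ χ_{0,2n}` (the same subspace, literal respelling). -/
theorem mem_bideg_of_mem_weilClassesMinus {n d : ℕ} {c : complexBetti A.X (2 * n)} (hc : c ∈ weilClassesMinus A φ n d) :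
    c ∈ pullbackEigenclasses A φ (2 * n) (bideg d 0 (2 * n)) := by
  rw [mem_pullbackEigenclasses_iff]
  intro x y
  rw [(mem_weilClassesMinus_iff.mp hc) x y, bideg_apply, pow_zero, one_mul]

/-- cup products of eigenclasses of bidegrees `(a, b)`, `(a', b')` are eigenclasses of bidegree `(a + a', b + b')`
(the tree's `cupProduct_mem_pullbackEigenclasses`, respelled). -/
theorem cupProduct_mem_bideg {k l m : ℕ} (h : k + l = m) {d a b a' b' : ℕ} {u : complexBetti A.X k} {v : complexBetti A.X l}
    (hu : u ∈ pullbackEigenclasses A φ k (bideg d a b)) (hv : v ∈ pullbackEigenclasses A φ l (bideg d a' b')) :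
    cupProduct h u v ∈ pullbackEigenclasses A φ m (bideg d (a + a') (b + b')) := by
  have h' := cupProduct_mem_pullbackEigenclasses h hu hv
  have e : (fun x y => bideg d a b x y * bideg d a' b' x y) = bideg d (a + a') (b + b') := by
    funext x y
    exact bideg_mul d a b a' b' x y
  rw [e] at h'
  exact h'

/-- powers of a balanced degree-`2` class: `h ∈ χ_{1,1} ⟹ hᵖ ∈ χ_{p,p}`. -/
theorem cupPowTwo_mem_bideg {d : ℕ} {h : complexBetti A.X 2} (hh : h ∈ pullbackEigenclasses A φ 2 (bideg d 1 1)) (p : ℕ) :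
    cupPowTwo h p ∈ pullbackEigenclasses A φ (2 * p) (bideg d p p) := by
  induction p with
  | zero =>
    rw [mem_pullbackEigenclasses_iff]
    intro x y
    rw [cupPowTwo_zero, bideg_apply, pow_zero, pow_zero, one_mul, one_smul]
    exact singularCohomology.map_one _
  | succ p ih =>
    rw [cupPowTwo_succ]
    exact cupProduct_mem_bideg (two_mul_add_two p) ih hh

end Characters

/-! ## §15.1 Top degree of an abelian variety with `φ² = -d`: `H^{2g} = χ_{g,g}`, every other bidegree vanishes there, and
## `W ∪ χ_{n,n} = 0` on a `2n`-fold -/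

section TopDegree

variable {A : AbelianVariety ℂ} {φ : A ⟶ A} {d : ℕ}

/-- **`H^{2g}(A(ℂ); ℂ) = χ_{g,g}`** (`g = dim A`): in the tree's character decomposition `H^k = Σ_{a+b=k, a,b ≤ g} χ_{a,b}` the
top degree `k = 2g` has the single summand `a = b = g` (`⋀^{2g}(V₊ ⊕ V₋) = ⋀ᵍV₊ ⊗ ⋀ᵍV₋`): every test isogeny `x·𝟙 + y·φ` acts on
the top cohomology by its DEGREE `(x² + d y²)ᵍ`. [cite: vanGeemen1994HodgeAV, 4.9 and proof of Thm. 6.12] -/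
theorem pullbackEigenclasses_top_eq_top (hd : 0 < d) (hφ : φ ≫ φ = -(d • 𝟙 A)) :
    pullbackEigenclasses A φ (2 * A.dim) (bideg d A.dim A.dim) = ⊤ := by
  rw [eq_top_iff, ← iSup_pullbackEigenclasses_weilCharacter_eq_top hd hφ (2 * A.dim)]
  refine iSup_le fun a ↦ iSup_le fun b ↦ iSup_le fun hab ↦ iSup_le fun ha ↦ iSup_le fun hb ↦ ?_
  obtain rfl : a = A.dim := by omega
  obtain rfl : b = A.dim := by omega
  exact le_of_eq rfl

/-- **a top-degree eigenclass of a character that ONE test pair separates from `χ_{g,g}` is zero.** -/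
theorem eq_zero_of_mem_pullbackEigenclasses_top (hd : 0 < d) (hφ : φ ≫ φ = -(d • 𝟙 A)) {g : ℕ} (hg : A.dim = g) {k : ℕ}
    (hk : k = 2 * g) {χ : ℕ → ℕ → ℂ} {x y : ℕ} (hsep : χ x y ≠ bideg d g g x y) {c : complexBetti A.X k}
    (hc : c ∈ pullbackEigenclasses A φ k χ) : c = 0 := by
  subst hk
  subst hg
  have hc' : c ∈ pullbackEigenclasses A φ (2 * A.dim) (bideg d A.dim A.dim) := by
    rw [pullbackEigenclasses_top_eq_top hd hφ]
    trivial
  have h1 := (mem_pullbackEigenclasses_iff.mp hc) x y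
  have h2 := (mem_pullbackEigenclasses_iff.mp hc') x y
  rw [h1] at h2
  have h3 : (χ x y - bideg d A.dim A.dim x y) • c = 0 := by rw [sub_smul, h2, sub_self]
  rcases smul_eq_zero.mp h3 with h | h
  · exact absurd (sub_eq_zero.mp h) hsep
  · exact h

/-- `x + i√d ≠ 0 ≠ x − i√d` (non-zero imaginary part). -/
private theorem base_ne_zero (hd : 0 < d) (x : ℕ) :
    (x : ℂ) + ((1 : ℕ) : ℂ) * Complex.I * (Real.sqrt d : ℂ) ≠ 0 ∧
      (x : ℂ) - ((1 : ℕ) : ℂ) * Complex.I * (Real.sqrt d : ℂ) ≠ 0 := by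
  have hsq : (Real.sqrt d : ℝ) ≠ 0 := (Real.sqrt_pos.mpr (by exact_mod_cast hd)).ne'
  have him : (((1 : ℕ) : ℂ) * Complex.I * (Real.sqrt d : ℂ)).im = Real.sqrt d := by
    simp [Complex.mul_im]
  constructor
  · intro h
    have h' := congrArg Complex.im h
    rw [Complex.add_im, him, Complex.natCast_im, zero_add, Complex.zero_im] at h'
    exact hsq h'
  · intro h
    have h' := congrArg Complex.im h
    rw [Complex.sub_im, him, Complex.natCast_im, zero_sub, Complex.zero_im, neg_eq_zero] at h'
    exact hsq h'

/-- exponent algebra behind the separation of `χ_{k+a,b}` from `χ_{k,k}` (`a + b = k`): `uᵃūᵃ ≠ ū²ᵃ ⟹ u^{k+a}ūᵇ ≠ uᵏūᵏ`. -/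
private theorem sep_plus {u w : ℂ} (hu : u ≠ 0) (hw : w ≠ 0) {a b k : ℕ} (hab : a + b = k)
    (h : u ^ a * w ^ a ≠ w ^ (2 * a)) : u ^ (k + a) * w ^ b ≠ u ^ k * w ^ k := by
  subst hab
  intro e
  apply h
  have hne : u ^ (a + b) * w ^ b ≠ 0 := mul_ne_zero (pow_ne_zero _ hu) (pow_ne_zero _ hw)
  have e' : u ^ (a + b) * w ^ b * u ^ a = u ^ (a + b) * w ^ b * w ^ a := by
    calc u ^ (a + b) * w ^ b * u ^ a = u ^ (a + b + a) * w ^ b := by ring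
      _ = u ^ (a + b) * w ^ (a + b) := e
      _ = u ^ (a + b) * w ^ b * w ^ a := by ring
  have hua : u ^ a = w ^ a := mul_left_cancel₀ hne e'
  rw [hua]
  ring

/-- the mirror image: `uᵇūᵇ ≠ u²ᵇ ⟹ uᵃū^{k+b} ≠ uᵏūᵏ` (`a + b = k`). -/
private theorem sep_minus {u w : ℂ} (hu : u ≠ 0) (hw : w ≠ 0) {a b k : ℕ} (hab : a + b = k)
    (h : u ^ b * w ^ b ≠ u ^ (2 * b)) : u ^ a * w ^ (k + b) ≠ u ^ k * w ^ k := by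
  subst hab
  intro e
  apply h
  have hne : u ^ a * w ^ (a + b) ≠ 0 := mul_ne_zero (pow_ne_zero _ hu) (pow_ne_zero _ hw)
  have e' : u ^ a * w ^ (a + b) * w ^ b = u ^ a * w ^ (a + b) * u ^ b := by
    calc u ^ a * w ^ (a + b) * w ^ b = u ^ a * w ^ (a + b + b) := by ring
      _ = u ^ (a + b) * w ^ (a + b) := e
      _ = u ^ a * w ^ (a + b) * u ^ b := by ring
  have hwb : w ^ b = u ^ b := mul_left_cancel₀ hne e'
  rw [hwb]
  ring

/-- **THE WEIL PLANE IS KILLED BY EVERY MIXED SUMMAND IN TOP DEGREE.** On an abelian variety of dimension `2n` with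
`φ ≫ φ = -d` (`d ≥ 1`): for `w ∈ W = E₊ ⊔ E₋ ⊆ H²ⁿ` and `v ∈ χ_{a,b} ⊆ H²ⁿ` with `a + b = 2n`, `a, b ≥ 1`, **`w ∪ v = 0` in `H⁴ⁿ`**
— `E₊ ∪ χ_{a,b} ⊆ χ_{2n+a,b} = ⋀^{2n+a}V₊ ⊗ ⋀ᵇV₋ = 0` (`dim V₊ = 2n`) and symmetrically; on the carrier: `H⁴ⁿ = χ_{2n,2n}`
(`pullbackEigenclasses_top_eq_top`) and one test isogeny `x₀·𝟙 + φ` separates `χ_{2n+a,b}` from `χ_{2n,2n}` (`uᵃ ≠ ūᵃ`, from the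
tree's `exists_pos_nat_separating_weilCharacters`). This is the cohomological form of «the Weil classes pair to zero with everything
but Weil classes» (`W ⊆` primitive classes, `H²ⁿ = W ⊕ W'`). [cite: vanGeemen1994HodgeAV, 4.9, Lemma 5.2 and proof of Thm. 6.12] -/
theorem cupProduct_eq_zero_of_mem_weilClassesOf_of_mem_mixed (hd : 0 < d) (hφ : φ ≫ φ = -(d • 𝟙 A)) {n : ℕ}
    (hA : A.dim = 2 * n) {k : ℕ} (hdeg : 2 * n + 2 * n = k) {a b : ℕ} (hab : a + b = 2 * n) (ha : 0 < a) (hb : 0 < b)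
    {w v : complexBetti A.X (2 * n)} (hw : w ∈ weilClassesOf A φ n d)
    (hv : v ∈ pullbackEigenclasses A φ (2 * n) (bideg d a b)) : cupProduct hdeg w v = 0 := by
  obtain ⟨x₁, -, hsep₁⟩ := exists_pos_nat_separating_weilCharacters hd (2 * a)
  obtain ⟨x₂, -, hsep₂⟩ := exists_pos_nat_separating_weilCharacters hd (2 * b)
  have h₁ := (hsep₁ a a (by omega) ha ha).2
  have h₂ := (hsep₂ b b (by omega) hb hb).1
  obtain ⟨hu₁, hū₁⟩ := base_ne_zero hd x₁
  obtain ⟨hu₂, hū₂⟩ := base_ne_zero hd x₂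
  have hk : k = 2 * (2 * n) := by omega
  obtain ⟨w₁, hw₁, w₂, hw₂, rfl⟩ := Submodule.mem_sup.mp hw
  have p₁ : cupProduct hdeg w₁ v ∈ pullbackEigenclasses A φ k (bideg d (2 * n + a) b) := by
    have h := cupProduct_mem_bideg hdeg (mem_bideg_of_mem_weilClassesPlus hw₁) hv
    rwa [zero_add] at h
  have p₂ : cupProduct hdeg w₂ v ∈ pullbackEigenclasses A φ k (bideg d a (2 * n + b)) := by
    have h := cupProduct_mem_bideg hdeg (mem_bideg_of_mem_weilClassesMinus hw₂) hv
    rwa [zero_add] at h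
  have s₁ : bideg d (2 * n + a) b x₁ 1 ≠ bideg d (2 * n) (2 * n) x₁ 1 := sep_plus hu₁ hū₁ hab h₁
  have s₂ : bideg d a (2 * n + b) x₂ 1 ≠ bideg d (2 * n) (2 * n) x₂ 1 := sep_minus hu₂ hū₂ hab h₂
  rw [map_add, LinearMap.add_apply, eq_zero_of_mem_pullbackEigenclasses_top hd hφ hA hk s₁ p₁,
    eq_zero_of_mem_pullbackEigenclasses_top hd hφ hA hk s₂ p₂, add_zero]

/-- the same with the mixed class on the left: `v ∪ w = 0`. -/
theorem cupProduct_eq_zero_of_mem_mixed_of_mem_weilClassesOf (hd : 0 < d) (hφ : φ ≫ φ = -(d • 𝟙 A)) {n : ℕ}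
    (hA : A.dim = 2 * n) {k : ℕ} (hdeg : 2 * n + 2 * n = k) {a b : ℕ} (hab : a + b = 2 * n) (ha : 0 < a) (hb : 0 < b)
    {v w : complexBetti A.X (2 * n)} (hv : v ∈ pullbackEigenclasses A φ (2 * n) (bideg d a b))
    (hw : w ∈ weilClassesOf A φ n d) : cupProduct hdeg v w = 0 := by
  obtain ⟨x₁, -, hsep₁⟩ := exists_pos_nat_separating_weilCharacters hd (2 * a)
  obtain ⟨x₂, -, hsep₂⟩ := exists_pos_nat_separating_weilCharacters hd (2 * b)
  have h₁ := (hsep₁ a a (by omega) ha ha).2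
  have h₂ := (hsep₂ b b (by omega) hb hb).1
  obtain ⟨hu₁, hū₁⟩ := base_ne_zero hd x₁
  obtain ⟨hu₂, hū₂⟩ := base_ne_zero hd x₂
  have hk : k = 2 * (2 * n) := by omega
  obtain ⟨w₁, hw₁, w₂, hw₂, rfl⟩ := Submodule.mem_sup.mp hw
  have p₁ : cupProduct hdeg v w₁ ∈ pullbackEigenclasses A φ k (bideg d (2 * n + a) b) := by
    have h := cupProduct_mem_bideg hdeg hv (mem_bideg_of_mem_weilClassesPlus hw₁)
    rwa [add_zero, show a + 2 * n = 2 * n + a from by ring] at h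
  have p₂ : cupProduct hdeg v w₂ ∈ pullbackEigenclasses A φ k (bideg d a (2 * n + b)) := by
    have h := cupProduct_mem_bideg hdeg hv (mem_bideg_of_mem_weilClassesMinus hw₂)
    rwa [add_zero, show b + 2 * n = 2 * n + b from by ring] at h
  have s₁ : bideg d (2 * n + a) b x₁ 1 ≠ bideg d (2 * n) (2 * n) x₁ 1 := sep_plus hu₁ hū₁ hab h₁
  have s₂ : bideg d a (2 * n + b) x₂ 1 ≠ bideg d (2 * n) (2 * n) x₂ 1 := sep_minus hu₂ hū₂ hab h₂
  rw [map_add, eq_zero_of_mem_pullbackEigenclasses_top hd hφ hA hk s₁ p₁,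
    eq_zero_of_mem_pullbackEigenclasses_top hd hφ hA hk s₂ p₂, add_zero]

/-- **`W ∪ W' = 0` in top degree**, `W' = ⨆_{a+b=2n, a,b≥1} χ_{a,b}` the span of the mixed summands (spelled LITERALLY as in the
tree's `weilClassesOf_sup_nonWeil_eq_top ∕ weilClassesOf_inf_nonWeil_eq_bot`, which give `H²ⁿ = W ⊕ W'`). -/
theorem cupProduct_eq_zero_of_mem_weilClassesOf_of_mem_nonWeil (hd : 0 < d) (hφ : φ ≫ φ = -(d • 𝟙 A)) {n : ℕ}
    (hA : A.dim = 2 * n) {k : ℕ} (hdeg : 2 * n + 2 * n = k) {w v : complexBetti A.X (2 * n)}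
    (hw : w ∈ weilClassesOf A φ n d)
    (hv : v ∈ ⨆ (a : ℕ) (b : ℕ) (_ : a + b = 2 * n) (_ : 0 < a) (_ : 0 < b),
        pullbackEigenclasses A φ (2 * n) (fun x y =>
          ((x : ℂ) + (y : ℂ) * Complex.I * (Real.sqrt d : ℂ)) ^ a *
            ((x : ℂ) - (y : ℂ) * Complex.I * (Real.sqrt d : ℂ)) ^ b)) :
    cupProduct hdeg w v = 0 := by
  let S : complexBetti A.X (2 * n) → Prop := fun v => cupProduct hdeg w v = 0
  have hzero : S 0 := by
    show cupProduct hdeg w 0 = 0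
    exact map_zero _
  have hadd : ∀ u v : complexBetti A.X (2 * n), S u → S v → S (u + v) := by
    intro u v hu hv
    show cupProduct hdeg w (u + v) = 0
    rw [map_add, hu, hv, add_zero]
  refine Submodule.iSup_induction _ (motive := S) hv (fun a c hc => ?_) hzero hadd
  refine Submodule.iSup_induction _ (motive := S) hc (fun b c hc => ?_) hzero hadd
  refine Submodule.iSup_induction _ (motive := S) hc (fun hab c hc => ?_) hzero hadd
  refine Submodule.iSup_induction _ (motive := S) hc (fun ha c hc => ?_) hzero hadd
  refine Submodule.iSup_induction _ (motive := S) hc (fun hb c hc => ?_) hzero hadd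
  exact cupProduct_eq_zero_of_mem_weilClassesOf_of_mem_mixed hd hφ hA hdeg hab ha hb hw hc

/-- **`W' ∪ W = 0` in top degree.** -/
theorem cupProduct_eq_zero_of_mem_nonWeil_of_mem_weilClassesOf (hd : 0 < d) (hφ : φ ≫ φ = -(d • 𝟙 A)) {n : ℕ}
    (hA : A.dim = 2 * n) {k : ℕ} (hdeg : 2 * n + 2 * n = k) {v w : complexBetti A.X (2 * n)}
    (hv : v ∈ ⨆ (a : ℕ) (b : ℕ) (_ : a + b = 2 * n) (_ : 0 < a) (_ : 0 < b),
        pullbackEigenclasses A φ (2 * n) (fun x y =>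
          ((x : ℂ) + (y : ℂ) * Complex.I * (Real.sqrt d : ℂ)) ^ a *
            ((x : ℂ) - (y : ℂ) * Complex.I * (Real.sqrt d : ℂ)) ^ b))
    (hw : w ∈ weilClassesOf A φ n d) : cupProduct hdeg v w = 0 := by
  let S : complexBetti A.X (2 * n) → Prop := fun v => cupProduct hdeg v w = 0
  have hzero : S 0 := by
    show cupProduct hdeg 0 w = 0
    rw [map_zero, LinearMap.zero_apply]
  have hadd : ∀ u v : complexBetti A.X (2 * n), S u → S v → S (u + v) := by
    intro u v hu hv
    show cupProduct hdeg (u + v) w = 0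
    rw [map_add, LinearMap.add_apply, hu, hv, add_zero]
  refine Submodule.iSup_induction _ (motive := S) hv (fun a c hc => ?_) hzero hadd
  refine Submodule.iSup_induction _ (motive := S) hc (fun b c hc => ?_) hzero hadd
  refine Submodule.iSup_induction _ (motive := S) hc (fun hab c hc => ?_) hzero hadd
  refine Submodule.iSup_induction _ (motive := S) hc (fun ha c hc => ?_) hzero hadd
  refine Submodule.iSup_induction _ (motive := S) hc (fun hb c hc => ?_) hzero hadd
  exact cupProduct_eq_zero_of_mem_mixed_of_mem_weilClassesOf hd hφ hA hdeg hab ha hb hc hw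

/-- **the top pairing with a Weil class sees only the `W`-component**: for every `x ∈ H²ⁿ = W ⊕ W'` there is `x_W ∈ W` (its Weil
component) with `w ∪ x = w ∪ x_W` for all Weil `w`. -/
theorem exists_mem_weilClassesOf_cupProduct_eq (hd : 0 < d) (hφ : φ ≫ φ = -(d • 𝟙 A)) {n : ℕ} (hA : A.dim = 2 * n) {k : ℕ}
    (hdeg : 2 * n + 2 * n = k) (x : complexBetti A.X (2 * n)) :
    ∃ xW ∈ weilClassesOf A φ n d, ∀ w ∈ weilClassesOf A φ n d, cupProduct hdeg w x = cupProduct hdeg w xW := by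
  have hx : x ∈ weilClassesOf A φ n d ⊔
      ⨆ (a : ℕ) (b : ℕ) (_ : a + b = 2 * n) (_ : 0 < a) (_ : 0 < b),
        pullbackEigenclasses A φ (2 * n) (fun x y =>
          ((x : ℂ) + (y : ℂ) * Complex.I * (Real.sqrt d : ℂ)) ^ a *
            ((x : ℂ) - (y : ℂ) * Complex.I * (Real.sqrt d : ℂ)) ^ b) := by
    rw [weilClassesOf_sup_nonWeil_eq_top hd hφ]
    trivial
  obtain ⟨xW, hxW, xM, hxM, rfl⟩ := Submodule.mem_sup.mp hx
  refine ⟨xW, hxW, fun w hw => ?_⟩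
  rw [map_add, cupProduct_eq_zero_of_mem_weilClassesOf_of_mem_nonWeil hd hφ hA hdeg hw hxM, add_zero]

/-- **`W ∪ χ_{n,n} = 0`**: the balanced bidegree `(n, n)` is a mixed summand (`n ≥ 1`) — in particular `w ∪ hⁿ = 0` for every
`K`-balanced degree-`2` class `h` (§15.2): the Weil classes are invisible to every `h`-degree. -/
theorem cupProduct_eq_zero_of_mem_weilClassesOf_of_mem_bideg (hd : 0 < d) (hφ : φ ≫ φ = -(d • 𝟙 A)) {n : ℕ} (hn : 0 < n)
    (hA : A.dim = 2 * n) {k : ℕ} (hdeg : 2 * n + 2 * n = k) {w b : complexBetti A.X (2 * n)}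
    (hw : w ∈ weilClassesOf A φ n d) (hb : b ∈ pullbackEigenclasses A φ (2 * n) (bideg d n n)) :
    cupProduct hdeg w b = 0 :=
  cupProduct_eq_zero_of_mem_weilClassesOf_of_mem_mixed hd hφ hA hdeg (by ring) hn hn hw hb

/-- `χ_{n,n} ∪ W = 0`. -/
theorem cupProduct_eq_zero_of_mem_bideg_of_mem_weilClassesOf (hd : 0 < d) (hφ : φ ≫ φ = -(d • 𝟙 A)) {n : ℕ} (hn : 0 < n)
    (hA : A.dim = 2 * n) {k : ℕ} (hdeg : 2 * n + 2 * n = k) {w b : complexBetti A.X (2 * n)}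
    (hb : b ∈ pullbackEigenclasses A φ (2 * n) (bideg d n n)) (hw : w ∈ weilClassesOf A φ n d) :
    cupProduct hdeg b w = 0 :=
  cupProduct_eq_zero_of_mem_mixed_of_mem_weilClassesOf hd hφ hA hdeg (by ring) hn hn hb hw

/-- **`E₊` IS ISOTROPIC in top degree: `E₊ ∪ E₊ ⊆ χ_{4n,0} = ⋀^{4n}V₊ = 0`.** -/
theorem cupProduct_eq_zero_of_mem_weilClassesPlus_of_mem_weilClassesPlus (hd : 0 < d) (hφ : φ ≫ φ = -(d • 𝟙 A)) {n : ℕ}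
    (hn : 0 < n) (hA : A.dim = 2 * n) {k : ℕ} (hdeg : 2 * n + 2 * n = k) {w w' : complexBetti A.X (2 * n)}
    (hw : w ∈ weilClassesPlus A φ n d) (hw' : w' ∈ weilClassesPlus A φ n d) : cupProduct hdeg w w' = 0 := by
  obtain ⟨x₀, -, hsep⟩ := exists_pos_nat_separating_weilCharacters hd (2 * n + 2 * n)
  have h₁ := (hsep (2 * n) (2 * n) rfl (by omega) (by omega)).1
  have hk : k = 2 * (2 * n) := by omega
  have p : cupProduct hdeg w w' ∈ pullbackEigenclasses A φ k (bideg d (2 * n + 2 * n) (0 + 0)) :=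
    cupProduct_mem_bideg hdeg (mem_bideg_of_mem_weilClassesPlus hw) (mem_bideg_of_mem_weilClassesPlus hw')
  have s : bideg d (2 * n + 2 * n) (0 + 0) x₀ 1 ≠ bideg d (2 * n) (2 * n) x₀ 1 := by
    rw [bideg_apply, bideg_apply, add_zero, pow_zero, mul_one]
    exact fun e => h₁ e.symm
  exact eq_zero_of_mem_pullbackEigenclasses_top hd hφ hA hk s p

/-- **`E₋` IS ISOTROPIC in top degree: `E₋ ∪ E₋ ⊆ χ_{0,4n} = 0`.** (So on `W ⊗ ℂ = E₊ ⊕ E₋` the top pairing is carried by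
`E₊ × E₋` alone: the Gram shape of `H²ⁿ = E₊ ⊕ E₋ ⊕ W'` in top degree is `E₊·E₊ = E₋·E₋ = W·W' = W'·W = 0`.) -/
theorem cupProduct_eq_zero_of_mem_weilClassesMinus_of_mem_weilClassesMinus (hd : 0 < d) (hφ : φ ≫ φ = -(d • 𝟙 A)) {n : ℕ}
    (hn : 0 < n) (hA : A.dim = 2 * n) {k : ℕ} (hdeg : 2 * n + 2 * n = k) {w w' : complexBetti A.X (2 * n)}
    (hw : w ∈ weilClassesMinus A φ n d) (hw' : w' ∈ weilClassesMinus A φ n d) : cupProduct hdeg w w' = 0 := by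
  obtain ⟨x₀, -, hsep⟩ := exists_pos_nat_separating_weilCharacters hd (2 * n + 2 * n)
  have h₂ := (hsep (2 * n) (2 * n) rfl (by omega) (by omega)).2
  have hk : k = 2 * (2 * n) := by omega
  have p : cupProduct hdeg w w' ∈ pullbackEigenclasses A φ k (bideg d (0 + 0) (2 * n + 2 * n)) :=
    cupProduct_mem_bideg hdeg (mem_bideg_of_mem_weilClassesMinus hw) (mem_bideg_of_mem_weilClassesMinus hw')
  have s : bideg d (0 + 0) (2 * n + 2 * n) x₀ 1 ≠ bideg d (2 * n) (2 * n) x₀ 1 := by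
    rw [bideg_apply, bideg_apply, add_zero, pow_zero, one_mul]
    exact fun e => h₂ e.symm
  exact eq_zero_of_mem_pullbackEigenclasses_top hd hφ hA hk s p

end TopDegree

/-! ## §15.2 The `K`-symmetrisation of any degree-`2` class is balanced; the stub's `h_K = symH ψ e a` (EVERY `(e, a)`) and the
## frame's `h_std` are balanced -/

section Balanced

variable {B : AbelianVariety ℂ} {ψ : B ⟶ B} {d : ℕ}

/-- **`d·c + ψ^*c ∈ χ_{1,1}` for every `c ∈ H²(B(ℂ); ℂ)`** (`ψ ≫ ψ = -d`, `d ≥ 1`): in `H² = χ_{2,0} ⊕ χ_{1,1} ⊕ χ_{0,2}` the pull-back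
`ψ^* = (0·𝟙 + 1·ψ)^*` acts by `−d, d, −d`, so the symmetrisation kills the outer summands and doubles the middle one. (v8 §11.1 proves the
same statement as `natCast_smul_add_map_mem_balanced` over `balancedChar`; v8 is not importable on the current snapshot, hence this
re-derivation over `bideg`.) [cite: vanGeemen1994HodgeAV, 4.9 and Lemma 5.2 (2)] -/
theorem natCast_smul_add_map_mem_bideg (hd : 0 < d) (hψ : ψ ≫ ψ = -(d • 𝟙 B)) (c : complexBetti B.X 2) :
    (d : ℂ) • c + complexBetti.map ψ.hom.hom.hom 2 c ∈ pullbackEigenclasses B ψ 2 (bideg d 1 1) := by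
  have hc : c ∈ ⨆ (a : ℕ) (b : ℕ) (_ : a + b = 2) (_ : a ≤ B.dim) (_ : b ≤ B.dim),
      pullbackEigenclasses B ψ 2 (fun x y =>
        ((x : ℂ) + (y : ℂ) * Complex.I * (Real.sqrt d : ℂ)) ^ a *
          ((x : ℂ) - (y : ℂ) * Complex.I * (Real.sqrt d : ℂ)) ^ b) := by
    rw [iSup_pullbackEigenclasses_weilCharacter_eq_top hd hψ 2]
    trivial
  let S : complexBetti B.X 2 → Prop := fun c =>
    (d : ℂ) • c + complexBetti.map ψ.hom.hom.hom 2 c ∈ pullbackEigenclasses B ψ 2 (bideg d 1 1)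
  have hzero : S 0 := by
    show (d : ℂ) • (0 : complexBetti B.X 2) + complexBetti.map ψ.hom.hom.hom 2 0 ∈ _
    rw [smul_zero, map_zero, add_zero]
    exact Submodule.zero_mem _
  have hadd : ∀ u v : complexBetti B.X 2, S u → S v → S (u + v) := by
    intro u v hu hv
    show (d : ℂ) • (u + v) + complexBetti.map ψ.hom.hom.hom 2 (u + v) ∈ _
    rw [smul_add, map_add, add_add_add_comm]
    exact Submodule.add_mem _ hu hv
  refine Submodule.iSup_induction _ (motive := S) hc (fun a c hc => ?_) hzero hadd
  refine Submodule.iSup_induction _ (motive := S) hc (fun b c hc => ?_) hzero hadd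
  refine Submodule.iSup_induction _ (motive := S) hc (fun hab c hc => ?_) hzero hadd
  refine Submodule.iSup_induction _ (motive := S) hc (fun _ c hc => ?_) hzero hadd
  refine Submodule.iSup_induction _ (motive := S) hc (fun _ c hc => ?_) hzero hadd
  -- `hc : c ∈ χ_{a,b}`, `a + b = 2`: the action of `ψ^* = (0·𝟙 + 1·ψ)^*` on `c`
  have hψc : complexBetti.map ψ.hom.hom.hom 2 c =
      ((Complex.I * (Real.sqrt d : ℂ)) ^ a * (-(Complex.I * (Real.sqrt d : ℂ))) ^ b) • c := by
    have h01 := (mem_pullbackEigenclasses_iff.mp hc) 0 1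
    have e : ((0 : ℕ) • 𝟙 B + (1 : ℕ) • ψ : B ⟶ B) = ψ := by simp
    rw [e] at h01
    change complexBetti.map ψ.hom.hom.hom 2 c = _ at h01
    rw [h01]
    congr 1
    push_cast
    ring
  have hsq : (Complex.I * (Real.sqrt d : ℂ)) ^ 2 = -(d : ℂ) := I_mul_sqrt_sq d
  show (d : ℂ) • c + complexBetti.map ψ.hom.hom.hom 2 c ∈ pullbackEigenclasses B ψ 2 (bideg d 1 1)
  rcases Nat.lt_or_ge a 1 with ha | ha
  · obtain rfl : a = 0 := by omega
    obtain rfl : b = 2 := by omega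
    rw [hψc, pow_zero, one_mul, neg_pow, hsq]
    norm_num
  rcases Nat.lt_or_ge a 2 with ha2 | ha2
  · obtain rfl : a = 1 := by omega
    obtain rfl : b = 1 := by omega
    have hc' : c ∈ pullbackEigenclasses B ψ 2 (bideg d 1 1) := hc
    exact Submodule.add_mem _ (Submodule.smul_mem _ _ hc') (by rw [hψc]; exact Submodule.smul_mem _ _ hc')
  · obtain rfl : a = 2 := by omega
    obtain rfl : b = 0 := by omega
    rw [hψc, pow_zero, mul_one, hsq]
    norm_num

/-- a `ψ`-INVARIANT degree-`2` class (`d = 1`) is balanced: `c + ψ^*c = 2c ∈ χ_{1,1}`. -/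
theorem mem_bideg_of_map_eq_self (hψ : ψ ≫ ψ = -(1 • 𝟙 B)) {c : complexBetti B.X 2}
    (hc : complexBetti.map ψ.hom.hom.hom 2 c = c) : c ∈ pullbackEigenclasses B ψ 2 (bideg 1 1 1) := by
  have h := natCast_smul_add_map_mem_bideg one_pos hψ c
  rw [hc, Nat.cast_one, one_smul, ← two_smul ℂ] at h
  exact (Submodule.smul_mem_iff _ (two_ne_zero : (2 : ℂ) ≠ 0)).mp h

variable {E₀ : AbelianVariety ℂ} {ψ₀ : E₀ ⟶ E₀}

/-- **the stub's `h_K = symH ψ e a = 1·e^*a + ψ^*e^*a` is balanced for EVERY projective embedding `e` and EVERY class `a`** — no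
compatibility of `(e, a)` with the frame and no hyperbolicity is needed. -/
theorem symH_mem_bideg (hψ : ψ₀ ≫ ψ₀ = -(1 • 𝟙 E₀)) (e : ProjectiveEmbedding (pad4Anchor E₀).X)
    (a : complexBetti (projectiveSpace e.n ℂ) 2) :
    symH (pad4Action E₀ ψ₀) e a ∈ pullbackEigenclasses (pad4Anchor E₀) (pad4Action E₀ ψ₀) 2 (bideg 1 1 1) :=
  natCast_smul_add_map_mem_bideg one_pos (pad4Action_comp_self hψ) (complexBetti.map e.ι 2 a)

/-- **the frame's `h_std` is balanced** (`ψ^* h_std = h_std`, v4 `map_pad4Action_hStd`). -/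
theorem hStd_mem_bideg (hE : E₀.dim = 1) (hψ : ψ₀ ≫ ψ₀ = -(1 • 𝟙 E₀)) (η : complexBetti E₀.X 2) :
    hStd E₀ η ∈ pullbackEigenclasses (pad4Anchor E₀) (pad4Action E₀ ψ₀) 2 (bideg 1 1 1) :=
  mem_bideg_of_map_eq_self (pad4Action_comp_self hψ) (map_pad4Action_hStd hE hψ)

end Balanced

/-! ## §15.3 On the pad-4 anchor: every Weil class is killed by `h⁴` in `H¹⁶(S⁴(ℂ); ℂ)` -/

section Anchor

variable {E₀ : AbelianVariety ℂ} {ψ₀ : E₀ ⟶ E₀}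

/-- the degree bookkeeping `H⁸ × H⁸ → H¹⁶` in the spelling `2·4 + 2·4 = 2·8` matching `cupPowTwo h 8`. -/
theorem deg448 : 2 * 4 + 2 * 4 = 2 * 8 := by norm_num

/-- **`w ∪ b = 0` in `H¹⁶(S⁴)` for every Weil class `w ∈ W_K ⊗ ℂ` of the anchor and every balanced `b ∈ χ_{4,4} ⊆ H⁸`.** -/
theorem weil_cupProduct_bideg_eq_zero (hE : E₀.dim = 1) (hψ : ψ₀ ≫ ψ₀ = -(1 • 𝟙 E₀))
    {w : complexBetti (pad4Anchor E₀).X (2 * 4)} (hw : w ∈ weilClassesOf (pad4Anchor E₀) (pad4Action E₀ ψ₀) 4 1)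
    {b : complexBetti (pad4Anchor E₀).X (2 * 4)}
    (hb : b ∈ pullbackEigenclasses (pad4Anchor E₀) (pad4Action E₀ ψ₀) (2 * 4) (bideg 1 4 4)) :
    cupProduct deg448 w b = 0 :=
  cupProduct_eq_zero_of_mem_weilClassesOf_of_mem_bideg one_pos (pad4Action_comp_self hψ) (by norm_num) (pad4Anchor_dim hE)
    deg448 hw hb

theorem bideg_cupProduct_weil_eq_zero (hE : E₀.dim = 1) (hψ : ψ₀ ≫ ψ₀ = -(1 • 𝟙 E₀))
    {b : complexBetti (pad4Anchor E₀).X (2 * 4)}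
    (hb : b ∈ pullbackEigenclasses (pad4Anchor E₀) (pad4Action E₀ ψ₀) (2 * 4) (bideg 1 4 4))
    {w : complexBetti (pad4Anchor E₀).X (2 * 4)} (hw : w ∈ weilClassesOf (pad4Anchor E₀) (pad4Action E₀ ψ₀) 4 1) :
    cupProduct deg448 b w = 0 :=
  cupProduct_eq_zero_of_mem_bideg_of_mem_weilClassesOf one_pos (pad4Action_comp_self hψ) (by norm_num) (pad4Anchor_dim hE)
    deg448 hb hw

/-- **`w ∪ h⁴ = 0` for every Weil class `w` and every balanced degree-`2` class `h`.** -/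
theorem weil_cupProduct_hPow_eq_zero (hE : E₀.dim = 1) (hψ : ψ₀ ≫ ψ₀ = -(1 • 𝟙 E₀))
    {w : complexBetti (pad4Anchor E₀).X (2 * 4)} (hw : w ∈ weilClassesOf (pad4Anchor E₀) (pad4Action E₀ ψ₀) 4 1)
    {h : complexBetti (pad4Anchor E₀).X 2} (hh : h ∈ pullbackEigenclasses (pad4Anchor E₀) (pad4Action E₀ ψ₀) 2 (bideg 1 1 1)) :
    cupProduct deg448 w (cupPowTwo h 4) = 0 :=
  weil_cupProduct_bideg_eq_zero hE hψ hw (cupPowTwo_mem_bideg hh 4)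

/-- **`w ∪ h_K⁴ = 0` for the stub's `h_K = symH ψ e a`, EVERY `(e, a)`, every Weil class `w`.** -/
theorem weil_cupProduct_symHPow_eq_zero (hE : E₀.dim = 1) (hψ : ψ₀ ≫ ψ₀ = -(1 • 𝟙 E₀))
    (e : ProjectiveEmbedding (pad4Anchor E₀).X) (a : complexBetti (projectiveSpace e.n ℂ) 2)
    {w : complexBetti (pad4Anchor E₀).X (2 * 4)} (hw : w ∈ weilClassesOf (pad4Anchor E₀) (pad4Action E₀ ψ₀) 4 1) :
    cupProduct deg448 w (cupPowTwo (symH (pad4Action E₀ ψ₀) e a) 4) = 0 :=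
  weil_cupProduct_hPow_eq_zero hE hψ hw (symH_mem_bideg hψ e a)

/-- **`w ∪ h_std⁴ = 0`** for every Weil class `w`. -/
theorem weil_cupProduct_hStdPow_eq_zero (hE : E₀.dim = 1) (hψ : ψ₀ ≫ ψ₀ = -(1 • 𝟙 E₀)) (η : complexBetti E₀.X 2)
    {w : complexBetti (pad4Anchor E₀).X (2 * 4)} (hw : w ∈ weilClassesOf (pad4Anchor E₀) (pad4Action E₀ ψ₀) 4 1) :
    cupProduct deg448 w (cupPowTwo (hStd E₀ η) 4) = 0 :=
  weil_cupProduct_hPow_eq_zero hE hψ hw (hStd_mem_bideg hE hψ η)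

/-- the frame classes `wOf μ = Re μ·r₁ + Im μ·r₂` are killed by `h⁴`. -/
theorem wOf_cupProduct_hPow_eq_zero (hE : E₀.dim = 1) (hψ : ψ₀ ≫ ψ₀ = -(1 • 𝟙 E₀)) (F : WeilFrame E₀ ψ₀) (μ : GaussianInt)
    {h : complexBetti (pad4Anchor E₀).X 2} (hh : h ∈ pullbackEigenclasses (pad4Anchor E₀) (pad4Action E₀ ψ₀) 2 (bideg 1 1 1)) :
    cupProduct deg448 (F.wOf μ) (cupPowTwo h 4) = 0 :=
  weil_cupProduct_hPow_eq_zero hE hψ (F.wOf_mem μ) hh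

/-- `h⁴ ∪ wOf μ = 0`. -/
theorem hPow_cupProduct_wOf_eq_zero (hE : E₀.dim = 1) (hψ : ψ₀ ≫ ψ₀ = -(1 • 𝟙 E₀)) (F : WeilFrame E₀ ψ₀) (μ : GaussianInt)
    {h : complexBetti (pad4Anchor E₀).X 2} (hh : h ∈ pullbackEigenclasses (pad4Anchor E₀) (pad4Action E₀ ψ₀) 2 (bideg 1 1 1)) :
    cupProduct deg448 (cupPowTwo h 4) (F.wOf μ) = 0 :=
  bideg_cupProduct_weil_eq_zero hE hψ (cupPowTwo_mem_bideg hh 4) (F.wOf_mem μ)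

/-- **on the anchor, `E₊ ∪ E₊ = 0` in `H¹⁶(S⁴)`** (`E₊ = weilClassesPlus … 4 1 ⊆ H⁸`). -/
theorem weilPlus_cupProduct_weilPlus_eq_zero (hE : E₀.dim = 1) (hψ : ψ₀ ≫ ψ₀ = -(1 • 𝟙 E₀))
    {w w' : complexBetti (pad4Anchor E₀).X (2 * 4)} (hw : w ∈ weilClassesPlus (pad4Anchor E₀) (pad4Action E₀ ψ₀) 4 1)
    (hw' : w' ∈ weilClassesPlus (pad4Anchor E₀) (pad4Action E₀ ψ₀) 4 1) : cupProduct deg448 w w' = 0 :=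
  cupProduct_eq_zero_of_mem_weilClassesPlus_of_mem_weilClassesPlus one_pos (pad4Action_comp_self hψ) (by norm_num)
    (pad4Anchor_dim hE) deg448 hw hw'

/-- **on the anchor, `E₋ ∪ E₋ = 0` in `H¹⁶(S⁴)`.** -/
theorem weilMinus_cupProduct_weilMinus_eq_zero (hE : E₀.dim = 1) (hψ : ψ₀ ≫ ψ₀ = -(1 • 𝟙 E₀))
    {w w' : complexBetti (pad4Anchor E₀).X (2 * 4)} (hw : w ∈ weilClassesMinus (pad4Anchor E₀) (pad4Action E₀ ψ₀) 4 1)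
    (hw' : w' ∈ weilClassesMinus (pad4Anchor E₀) (pad4Action E₀ ψ₀) 4 1) : cupProduct deg448 w w' = 0 :=
  cupProduct_eq_zero_of_mem_weilClassesMinus_of_mem_weilClassesMinus one_pos (pad4Action_comp_self hψ) (by norm_num)
    (pad4Anchor_dim hE) deg448 hw hw'

end Anchor

/-! ## §15.4 The C5 class pairs with `h⁴` to `q·h⁸`: the Weil coordinate `μ` is INVISIBLE to the `h`-degree -/

section ClassPairing

variable {E₀ : AbelianVariety ℂ} {ψ₀ : E₀ ⟶ E₀}

/-- `h⁴ ∪ h⁴ = h⁸` (associativity of `∪`). [cite: HatcherAT2002, §3.2] -/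
theorem hPow4_cupProduct_hPow4 (h : complexBetti (pad4Anchor E₀).X 2) :
    cupProduct deg448 (cupPowTwo h 4) (cupPowTwo h 4) = cupPowTwo h 8 :=
  Literature.AlgebraicGeometry.HodgeTheory.cupProduct_cupPowTwo_cupPowTwo h (by norm_num) deg448

/-- **`(q·h⁴ + wOf μ) ∪ h⁴ = q·h⁸`** for every balanced `h` (in particular `h_K` and `h_std`): the C5 class of the checker
(`ClassCheck K μ i q`: `q·h_K⁴ + wOf μ` supported on `Z`) pairs with `h⁴` to the `h`-degree `q` ALONE — the Weil coordinate `μ` of the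
design does not enter any `h`-degree. -/
theorem classC5_cupProduct_hPow4 (hE : E₀.dim = 1) (hψ : ψ₀ ≫ ψ₀ = -(1 • 𝟙 E₀)) (F : WeilFrame E₀ ψ₀) (μ : GaussianInt) (q : ℚ)
    {h : complexBetti (pad4Anchor E₀).X 2} (hh : h ∈ pullbackEigenclasses (pad4Anchor E₀) (pad4Action E₀ ψ₀) 2 (bideg 1 1 1)) :
    cupProduct deg448 (((q : ℚ) : ℂ) • cupPowTwo h 4 + F.wOf μ) (cupPowTwo h 4) = ((q : ℚ) : ℂ) • cupPowTwo h 8 := by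
  rw [map_add, LinearMap.add_apply, map_smul, LinearMap.smul_apply, wOf_cupProduct_hPow_eq_zero hE hψ F μ hh, add_zero,
    hPow4_cupProduct_hPow4]

/-- the instance for the stub's `h_K = symH ψ e a` and a kit's frame (the class of `ClassCheck K μ i q`). -/
theorem classCheckClass_cupProduct_symHPow4 (hE : E₀.dim = 1) (hψ : ψ₀ ≫ ψ₀ = -(1 • 𝟙 E₀)) (K : AnchorKit E₀ ψ₀)
    (μ : GaussianInt) (q : ℚ) :
    cupProduct deg448 (((q : ℚ) : ℂ) • cupPowTwo (symH (pad4Action E₀ ψ₀) K.pol.e K.pol.a) 4 + K.F.wOf μ)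
        (cupPowTwo (symH (pad4Action E₀ ψ₀) K.pol.e K.pol.a) 4) =
      ((q : ℚ) : ℂ) • cupPowTwo (symH (pad4Action E₀ ψ₀) K.pol.e K.pol.a) 8 :=
  classC5_cupProduct_hPow4 hE hψ K.F μ q (symH_mem_bideg hψ K.pol.e K.pol.a)

/-- the instance for `h_std`. -/
theorem classC5_cupProduct_hStdPow4 (hE : E₀.dim = 1) (hψ : ψ₀ ≫ ψ₀ = -(1 • 𝟙 E₀)) (η : complexBetti E₀.X 2)
    (F : WeilFrame E₀ ψ₀) (μ : GaussianInt) (q : ℚ) :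
    cupProduct deg448 (((q : ℚ) : ℂ) • cupPowTwo (hStd E₀ η) 4 + F.wOf μ) (cupPowTwo (hStd E₀ η) 4) =
      ((q : ℚ) : ℂ) • cupPowTwo (hStd E₀ η) 8 :=
  classC5_cupProduct_hPow4 hE hψ F μ q (hStd_mem_bideg hE hψ η)

/-- `h⁴ ∪ (q·h⁴ + wOf μ) = q·h⁸`. -/
theorem hPow4_cupProduct_classC5 (hE : E₀.dim = 1) (hψ : ψ₀ ≫ ψ₀ = -(1 • 𝟙 E₀)) (F : WeilFrame E₀ ψ₀) (μ : GaussianInt) (q : ℚ)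
    {h : complexBetti (pad4Anchor E₀).X 2} (hh : h ∈ pullbackEigenclasses (pad4Anchor E₀) (pad4Action E₀ ψ₀) 2 (bideg 1 1 1)) :
    cupProduct deg448 (cupPowTwo h 4) (((q : ℚ) : ℂ) • cupPowTwo h 4 + F.wOf μ) = ((q : ℚ) : ℂ) • cupPowTwo h 8 := by
  rw [map_add, map_smul, hPow_cupProduct_wOf_eq_zero hE hψ F μ hh, add_zero, hPow4_cupProduct_hPow4]

/-- **the C5 class pairs with a Weil class through its Weil part only: `(q·h⁴ + wOf μ) ∪ w' = wOf μ ∪ w'`** (`w' ∈ W`): the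
`W`-block of the top pairing reads `μ`, the `h`-block reads `q`. -/
theorem classC5_cupProduct_weil (hE : E₀.dim = 1) (hψ : ψ₀ ≫ ψ₀ = -(1 • 𝟙 E₀)) (F : WeilFrame E₀ ψ₀) (μ : GaussianInt) (q : ℚ)
    {h : complexBetti (pad4Anchor E₀).X 2} (hh : h ∈ pullbackEigenclasses (pad4Anchor E₀) (pad4Action E₀ ψ₀) 2 (bideg 1 1 1))
    {w' : complexBetti (pad4Anchor E₀).X (2 * 4)} (hw' : w' ∈ weilClassesOf (pad4Anchor E₀) (pad4Action E₀ ψ₀) 4 1) :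
    cupProduct deg448 (((q : ℚ) : ℂ) • cupPowTwo h 4 + F.wOf μ) w' = cupProduct deg448 (F.wOf μ) w' := by
  rw [map_add, LinearMap.add_apply, map_smul, LinearMap.smul_apply,
    bideg_cupProduct_weil_eq_zero hE hψ (cupPowTwo_mem_bideg hh 4) hw', smul_zero, zero_add]

/-- **the product of two C5 classes: `(q·h⁴ + wOf μ) ∪ (q'·h⁴ + wOf μ') = (q q')·h⁸ + wOf μ ∪ wOf μ'`** — the cross terms
vanish (`W ⟂ h⁴`): the top pairing on the C5 lattice `ℚ·h⁴ ⊕ W_K` is BLOCK DIAGONAL. -/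
theorem classC5_cupProduct_classC5 (hE : E₀.dim = 1) (hψ : ψ₀ ≫ ψ₀ = -(1 • 𝟙 E₀)) (F : WeilFrame E₀ ψ₀)
    (μ μ' : GaussianInt) (q q' : ℚ)
    {h : complexBetti (pad4Anchor E₀).X 2} (hh : h ∈ pullbackEigenclasses (pad4Anchor E₀) (pad4Action E₀ ψ₀) 2 (bideg 1 1 1)) :
    cupProduct deg448 (((q : ℚ) : ℂ) • cupPowTwo h 4 + F.wOf μ) (((q' : ℚ) : ℂ) • cupPowTwo h 4 + F.wOf μ') =
      (((q : ℚ) : ℂ) * ((q' : ℚ) : ℂ)) • cupPowTwo h 8 + cupProduct deg448 (F.wOf μ) (F.wOf μ') := by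
  have e₁ : cupProduct deg448 (((q : ℚ) : ℂ) • cupPowTwo h 4 + F.wOf μ) (((q' : ℚ) : ℂ) • cupPowTwo h 4) =
      (((q : ℚ) : ℂ) * ((q' : ℚ) : ℂ)) • cupPowTwo h 8 := by
    rw [map_smul, classC5_cupProduct_hPow4 hE hψ F μ q hh, smul_smul, mul_comm (((q' : ℚ) : ℂ)) (((q : ℚ) : ℂ))]
  have e₂ : cupProduct deg448 (((q : ℚ) : ℂ) • cupPowTwo h 4 + F.wOf μ) (F.wOf μ') = cupProduct deg448 (F.wOf μ) (F.wOf μ') :=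
    classC5_cupProduct_weil hE hψ F μ q hh (F.wOf_mem μ')
  rw [← e₁, ← e₂, ← map_add]

end ClassPairing

/-! ## §15.5 The top line `H¹⁶(S⁴(ℂ); ℂ) = ℂ·h⁸` and the degree coordinate -/

section DegreeCoordinate

variable {E₀ : AbelianVariety ℂ} {ψ₀ : E₀ ⟶ E₀}

/-- **`dim H¹⁶(S⁴(ℂ); ℂ) = 1`** (`b_{2g} = 1`, the tree's `abelianVarietyCohomologyExteriorH1_holds`). -/
theorem finrank_top_pad4Anchor (hE : E₀.dim = 1) : Module.finrank ℂ (complexBetti (pad4Anchor E₀).X (2 * 8)) = 1 := by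
  have h := abelianVarietyCohomologyExteriorH1_holds.finrank_eq (pad4Anchor E₀) (2 * 8)
  rw [pad4Anchor_dim hE] at h
  rw [h]
  decide

/-- every top class is a multiple of `h⁸` once `h⁸ ≠ 0` (for the stub's `h_K` and for `h_std` of a polarised frame, `h⁸ ≠ 0` is v8's
`cupPowTwo_symH_ne_zero'` ∕ `cupPowTwo_hStd_ne_zero` — Kähler volume; not re-derived here). -/
theorem exists_eq_smul_hPow8 (hE : E₀.dim = 1) {h : complexBetti (pad4Anchor E₀).X 2} (h8 : cupPowTwo h 8 ≠ 0)
    (x : complexBetti (pad4Anchor E₀).X (2 * 8)) : ∃ c : ℂ, x = c • cupPowTwo h 8 := by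
  obtain ⟨c, hc⟩ := (finrank_eq_one_iff_of_nonzero' (cupPowTwo h 8) h8).mp (finrank_top_pad4Anchor hE) x
  exact ⟨c, hc.symm⟩

/-- **the `h`-DEGREE COORDINATE on `H¹⁶(S⁴)`**: the linear functional `deg_h` with `deg_h(h⁸) = 1` (the coordinate of the basis `{h⁸}`
of the top line). For `h` ample and the orientation in which `∫ h⁸ > 0` it is `x ↦ (∫ x)∕(∫ h⁸)`. -/
def hDegree (hE : E₀.dim = 1) (h : complexBetti (pad4Anchor E₀).X 2) (h8 : cupPowTwo h 8 ≠ 0) :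
    complexBetti (pad4Anchor E₀).X (2 * 8) →ₗ[ℂ] ℂ :=
  (FiniteDimensional.basisSingleton Unit (finrank_top_pad4Anchor hE) (cupPowTwo h 8) h8).coord ()

theorem hDegree_smul_hPow8 (hE : E₀.dim = 1) {h : complexBetti (pad4Anchor E₀).X 2} (h8 : cupPowTwo h 8 ≠ 0) (c : ℂ) :
    hDegree hE h h8 (c • cupPowTwo h 8) = c := by
  have hb := FiniteDimensional.basisSingleton_apply Unit (finrank_top_pad4Anchor hE) (cupPowTwo h 8) h8 ()
  calc hDegree hE h h8 (c • cupPowTwo h 8)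
      = hDegree hE h h8 (c • FiniteDimensional.basisSingleton Unit (finrank_top_pad4Anchor hE) (cupPowTwo h 8) h8 ()) := by
        rw [hb]
    _ = c := by
        rw [hDegree, Module.Basis.coord_apply, LinearEquiv.map_smul, Module.Basis.repr_self, Finsupp.smul_apply,
          Finsupp.single_eq_same, smul_eq_mul, mul_one]

theorem hDegree_hPow8 (hE : E₀.dim = 1) {h : complexBetti (pad4Anchor E₀).X 2} (h8 : cupPowTwo h 8 ≠ 0) :
    hDegree hE h h8 (cupPowTwo h 8) = 1 := by
  have h1 := hDegree_smul_hPow8 hE h8 1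
  rwa [one_smul] at h1

/-- `x = deg_h(x) · h⁸` for every top class `x`. -/
theorem eq_hDegree_smul (hE : E₀.dim = 1) {h : complexBetti (pad4Anchor E₀).X 2} (h8 : cupPowTwo h 8 ≠ 0)
    (x : complexBetti (pad4Anchor E₀).X (2 * 8)) : x = hDegree hE h h8 x • cupPowTwo h 8 := by
  obtain ⟨c, rfl⟩ := exists_eq_smul_hPow8 hE h8 x
  rw [hDegree_smul_hPow8]

/-- **THE DEGREE READING OF C5 (theorem form): `deg_h((q·h⁴ + wOf μ) ∪ h⁴) = q`** for every balanced `h` with `h⁸ ≠ 0` — the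
`h`-degree of the C5 class (normalised by `deg_h h⁸ = 1`) is its `ℚ[h]`-coordinate `q`; the Weil part is invisible. -/
theorem hDegree_classC5 (hE : E₀.dim = 1) (hψ : ψ₀ ≫ ψ₀ = -(1 • 𝟙 E₀)) (F : WeilFrame E₀ ψ₀) (μ : GaussianInt) (q : ℚ)
    {h : complexBetti (pad4Anchor E₀).X 2} (hh : h ∈ pullbackEigenclasses (pad4Anchor E₀) (pad4Action E₀ ψ₀) 2 (bideg 1 1 1))
    (h8 : cupPowTwo h 8 ≠ 0) :
    hDegree hE h h8 (cupProduct deg448 (((q : ℚ) : ℂ) • cupPowTwo h 4 + F.wOf μ) (cupPowTwo h 4)) = ((q : ℚ) : ℂ) := by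
  rw [classC5_cupProduct_hPow4 hE hψ F μ q hh, hDegree_smul_hPow8]

/-- and of a pure Weil class: `deg_h(wOf μ ∪ h⁴) = 0`. -/
theorem hDegree_wOf (hE : E₀.dim = 1) (hψ : ψ₀ ≫ ψ₀ = -(1 • 𝟙 E₀)) (F : WeilFrame E₀ ψ₀) (μ : GaussianInt)
    {h : complexBetti (pad4Anchor E₀).X 2} (hh : h ∈ pullbackEigenclasses (pad4Anchor E₀) (pad4Action E₀ ψ₀) 2 (bideg 1 1 1))
    (h8 : cupPowTwo h 8 ≠ 0) :
    hDegree hE h h8 (cupProduct deg448 (F.wOf μ) (cupPowTwo h 4)) = 0 := by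
  rw [wOf_cupProduct_hPow_eq_zero hE hψ F μ hh, map_zero]

/-- `deg_h(h⁴ ∪ h⁴) = 1`. -/
theorem hDegree_hPow4_hPow4 (hE : E₀.dim = 1) {h : complexBetti (pad4Anchor E₀).X 2} (h8 : cupPowTwo h 8 ≠ 0) :
    hDegree hE h h8 (cupProduct deg448 (cupPowTwo h 4) (cupPowTwo h 4)) = 1 := by
  rw [hPow4_cupProduct_hPow4, hDegree_hPow8]

/-- **`deg_h(σ ∪ σ') = q q' + deg_h(wOf μ ∪ wOf μ')`** for two C5 classes `σ = q·h⁴ + wOf μ`, `σ' = q'·h⁴ + wOf μ'`. -/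
theorem hDegree_classC5_classC5 (hE : E₀.dim = 1) (hψ : ψ₀ ≫ ψ₀ = -(1 • 𝟙 E₀)) (F : WeilFrame E₀ ψ₀)
    (μ μ' : GaussianInt) (q q' : ℚ)
    {h : complexBetti (pad4Anchor E₀).X 2} (hh : h ∈ pullbackEigenclasses (pad4Anchor E₀) (pad4Action E₀ ψ₀) 2 (bideg 1 1 1))
    (h8 : cupPowTwo h 8 ≠ 0) :
    hDegree hE h h8 (cupProduct deg448 (((q : ℚ) : ℂ) • cupPowTwo h 4 + F.wOf μ) (((q' : ℚ) : ℂ) • cupPowTwo h 4 + F.wOf μ')) =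
      ((q : ℚ) : ℂ) * ((q' : ℚ) : ℂ) + hDegree hE h h8 (cupProduct deg448 (F.wOf μ) (F.wOf μ')) := by
  rw [classC5_cupProduct_classC5 hE hψ F μ μ' q q' hh, map_add, hDegree_smul_hPow8]

/-- **every linear functional on the top line is a multiple of `deg_h`: `δ = δ(h⁸)·deg_h`** — so every orientation ∕ trace
functional `∫` computes the same Gram SIGNS as `deg_h` once `∫ h⁸` is real and non-zero (§15.7). -/
theorem linearForm_eq_mul_hDegree (hE : E₀.dim = 1) {h : complexBetti (pad4Anchor E₀).X 2} (h8 : cupPowTwo h 8 ≠ 0)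
    (δ : complexBetti (pad4Anchor E₀).X (2 * 8) →ₗ[ℂ] ℂ) (x : complexBetti (pad4Anchor E₀).X (2 * 8)) :
    δ x = δ (cupPowTwo h 8) * hDegree hE h h8 x := by
  conv_lhs => rw [eq_hDegree_smul hE h8 x]
  rw [map_smul, smul_eq_mul, mul_comm]

end DegreeCoordinate

/-! ## §15.6 The degree-sign reading of C5 under NAMED orientation hypotheses -/

section DegreeSign

variable {E₀ : AbelianVariety ℂ} {ψ₀ : E₀ ⟶ E₀}

/-- **DEGREE SIGN, typed.** Let `δ` be ANY linear functional on `H¹⁶(S⁴(ℂ); ℂ)` which is REAL AND POSITIVE on `h⁸` (an orientation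
in which `h` has positive volume — for an ample `h` this is `δ = ∫_{S⁴}`; NOT constructed here) and suppose the C5 class `σ = q·h⁴ + wOf μ`
pairs POSITIVELY with `h⁴` under `δ` (for `σ = cl(Z)`, `Z ≠ ∅` pure of codimension `4`, `δ(cl(Z) ∪ h⁴) = deg_h Z > 0`; NOT proved here).
Then **`q > 0`**: `δ(σ ∪ h⁴) = q·δ(h⁸)` by §15.4. This is the door behind the json screen «`degreeSignAt D t` = (`0 < c₄(D(t))`)» of
v11 §14.3: the two positivity inputs are its only non-typed content. -/
theorem ratCoeff_pos_of_oriented (hE : E₀.dim = 1) (hψ : ψ₀ ≫ ψ₀ = -(1 • 𝟙 E₀)) (F : WeilFrame E₀ ψ₀) (μ : GaussianInt) (q : ℚ)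
    {h : complexBetti (pad4Anchor E₀).X 2} (hh : h ∈ pullbackEigenclasses (pad4Anchor E₀) (pad4Action E₀ ψ₀) 2 (bideg 1 1 1))
    (δ : complexBetti (pad4Anchor E₀).X (2 * 8) →ₗ[ℂ] ℂ) {r₈ rZ : ℝ} (hr₈ : 0 < r₈) (hrZ : 0 < rZ)
    (hδ8 : δ (cupPowTwo h 8) = (r₈ : ℂ))
    (hδσ : δ (cupProduct deg448 (((q : ℚ) : ℂ) • cupPowTwo h 4 + F.wOf μ) (cupPowTwo h 4)) = (rZ : ℂ)) : 0 < q := by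
  rw [classC5_cupProduct_hPow4 hE hψ F μ q hh, map_smul, hδ8, smul_eq_mul] at hδσ
  have hre := congrArg Complex.re hδσ
  simp only [Complex.mul_re, Complex.ofReal_re, Complex.ofReal_im, Complex.ratCast_re, Complex.ratCast_im, mul_zero,
    sub_zero] at hre
  have hq : (0 : ℝ) < (q : ℝ) := by
    rcases lt_or_ge 0 (q : ℝ) with hlt | hle
    · exact hlt
    · exfalso
      have : (q : ℝ) * r₈ ≤ 0 := mul_nonpos_of_nonpos_of_nonneg hle hr₈.le
      linarith
  exact_mod_cast hq

/-- **the degree sign IS the sign of `q`, normalisation-free form**: with `δ = deg_h` itself (`deg_h h⁸ = 1 > 0` needs no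
orientation input), `0 < q ↔ 0 < Re deg_h(σ ∪ h⁴)`; the one remaining NAMED input of the json screen `degreeSignAt` (v11 §14.3) is
«`deg_h(cl(Z) ∪ h⁴) > 0` for a non-empty seed `Z` of pure codimension `4` and ample `h`» (NOT proved here). -/
theorem ratCoeff_pos_iff_hDegree_pos (hE : E₀.dim = 1) (hψ : ψ₀ ≫ ψ₀ = -(1 • 𝟙 E₀)) (F : WeilFrame E₀ ψ₀) (μ : GaussianInt)
    (q : ℚ) {h : complexBetti (pad4Anchor E₀).X 2}
    (hh : h ∈ pullbackEigenclasses (pad4Anchor E₀) (pad4Action E₀ ψ₀) 2 (bideg 1 1 1)) (h8 : cupPowTwo h 8 ≠ 0) :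
    0 < q ↔ 0 < (hDegree hE h h8 (cupProduct deg448 (((q : ℚ) : ℂ) • cupPowTwo h 4 + F.wOf μ) (cupPowTwo h 4))).re := by
  rw [hDegree_classC5 hE hψ F μ q hh h8, Complex.ratCast_re]
  exact_mod_cast Iff.rfl

/-- conversely the sign is NECESSARILY that of `q`: `δ(σ ∪ h⁴) = q·δ(h⁸)`, so with `δ(h⁸) = r₈ > 0` a NON-POSITIVE `q` gives a
non-positive pairing — a candidate `(D, t)` with `q ≤ 0` cannot be the class of a non-empty seed in a positively oriented degree. -/
theorem pairing_re_nonpos_of_ratCoeff_nonpos (hE : E₀.dim = 1) (hψ : ψ₀ ≫ ψ₀ = -(1 • 𝟙 E₀)) (F : WeilFrame E₀ ψ₀)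
    (μ : GaussianInt) {q : ℚ} (hq : q ≤ 0)
    {h : complexBetti (pad4Anchor E₀).X 2} (hh : h ∈ pullbackEigenclasses (pad4Anchor E₀) (pad4Action E₀ ψ₀) 2 (bideg 1 1 1))
    (δ : complexBetti (pad4Anchor E₀).X (2 * 8) →ₗ[ℂ] ℂ) {r₈ : ℝ} (hr₈ : 0 < r₈) (hδ8 : δ (cupPowTwo h 8) = (r₈ : ℂ)) :
    (δ (cupProduct deg448 (((q : ℚ) : ℂ) • cupPowTwo h 4 + F.wOf μ) (cupPowTwo h 4))).re ≤ 0 := by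
  rw [classC5_cupProduct_hPow4 hE hψ F μ q hh, map_smul, hδ8, smul_eq_mul]
  simp only [Complex.mul_re, Complex.ofReal_re, Complex.ofReal_im, Complex.ratCast_re, Complex.ratCast_im, mul_zero, sub_zero]
  have hq' : (q : ℝ) ≤ 0 := by exact_mod_cast hq
  exact mul_nonpos_of_nonpos_of_nonneg hq' hr₈.le

end DegreeSign

/-! ## §15.7 The Gram determinant of `(σ, h⁴)` is the Weil self-pairing: a numerical detector of the Weil coordinate AT THE SEED,
## under a NAMED Hodge–Riemann positivity hypothesis -/

section GramDetector

variable {E₀ : AbelianVariety ℂ} {ψ₀ : E₀ ⟶ E₀}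

/-- **the Gram determinant of `(σ, h⁴)` in the `h`-normalised top pairing**:
`G_h(σ) = deg_h(σ ∪ σ)·deg_h(h⁴ ∪ h⁴) − deg_h(σ ∪ h⁴)²`. For `σ = cl(Z)` the three entries are intersection numbers a presentation
can supply (`Z·Z`, `h⁸`, `Z·h⁴`, divided by `h⁸`); by `linearForm_gramDet` any orientation functional gives the same number up to the
positive factor `(∫h⁸)²`. -/
def gramDet (hE : E₀.dim = 1) (h : complexBetti (pad4Anchor E₀).X 2) (h8 : cupPowTwo h 8 ≠ 0)
    (σ : complexBetti (pad4Anchor E₀).X (2 * 4)) : ℂ :=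
  hDegree hE h h8 (cupProduct deg448 σ σ) * hDegree hE h h8 (cupProduct deg448 (cupPowTwo h 4) (cupPowTwo h 4)) -
    hDegree hE h h8 (cupProduct deg448 σ (cupPowTwo h 4)) ^ 2

theorem gramDet_eq (hE : E₀.dim = 1) (h : complexBetti (pad4Anchor E₀).X 2) (h8 : cupPowTwo h 8 ≠ 0)
    (σ : complexBetti (pad4Anchor E₀).X (2 * 4)) : gramDet hE h h8 σ =
      hDegree hE h h8 (cupProduct deg448 σ σ) * hDegree hE h h8 (cupProduct deg448 (cupPowTwo h 4) (cupPowTwo h 4)) -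
        hDegree hE h h8 (cupProduct deg448 σ (cupPowTwo h 4)) ^ 2 :=
  rfl

/-- **`G_h(q·h⁴ + wOf μ) = deg_h(wOf μ ∪ wOf μ)`**: the Gram determinant of the C5 class against `h⁴` is the self-pairing of its
WEIL PART — `q` cancels. -/
theorem gramDet_classC5 (hE : E₀.dim = 1) (hψ : ψ₀ ≫ ψ₀ = -(1 • 𝟙 E₀)) (F : WeilFrame E₀ ψ₀) (μ : GaussianInt) (q : ℚ)
    {h : complexBetti (pad4Anchor E₀).X 2} (hh : h ∈ pullbackEigenclasses (pad4Anchor E₀) (pad4Action E₀ ψ₀) 2 (bideg 1 1 1))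
    (h8 : cupPowTwo h 8 ≠ 0) :
    gramDet hE h h8 (((q : ℚ) : ℂ) • cupPowTwo h 4 + F.wOf μ) = hDegree hE h h8 (cupProduct deg448 (F.wOf μ) (F.wOf μ)) := by
  rw [gramDet_eq, hDegree_classC5_classC5 hE hψ F μ μ q q hh h8, hDegree_hPow4_hPow4 hE h8, hDegree_classC5 hE hψ F μ q hh h8]
  ring

/-- at `μ = 0` the Gram determinant vanishes (no hypothesis): `σ = q·h⁴` is proportional to `h⁴`. -/
theorem gramDet_classC5_of_mu_eq_zero (hE : E₀.dim = 1) (hψ : ψ₀ ≫ ψ₀ = -(1 • 𝟙 E₀)) (F : WeilFrame E₀ ψ₀) (q : ℚ)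
    {h : complexBetti (pad4Anchor E₀).X 2} (hh : h ∈ pullbackEigenclasses (pad4Anchor E₀) (pad4Action E₀ ψ₀) 2 (bideg 1 1 1))
    (h8 : cupPowTwo h 8 ≠ 0) : gramDet hE h h8 (((q : ℚ) : ℂ) • cupPowTwo h 4 + F.wOf 0) = 0 := by
  have h0 : F.wOf 0 = 0 := by
    rw [WeilFrame.wOf, Zsqrtd.re_zero, Zsqrtd.im_zero, Int.cast_zero, Rat.cast_zero, zero_smul, zero_smul, add_zero]
  rw [gramDet_classC5 hE hψ F 0 q hh h8, h0]
  simp only [map_zero]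

/-- **every orientation functional computes the same Gram determinant up to `(∫h⁸)²`**: for ANY linear `δ` on `H¹⁶(S⁴(ℂ); ℂ)`,
`δ(σσ)·δ(h⁴h⁴) − δ(σh⁴)² = δ(h⁸)²·G_h(σ)`. -/
theorem linearForm_gramDet (hE : E₀.dim = 1) {h : complexBetti (pad4Anchor E₀).X 2} (h8 : cupPowTwo h 8 ≠ 0)
    (δ : complexBetti (pad4Anchor E₀).X (2 * 8) →ₗ[ℂ] ℂ) (σ : complexBetti (pad4Anchor E₀).X (2 * 4)) :
    δ (cupProduct deg448 σ σ) * δ (cupProduct deg448 (cupPowTwo h 4) (cupPowTwo h 4)) - δ (cupProduct deg448 σ (cupPowTwo h 4)) ^ 2 =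
      δ (cupPowTwo h 8) ^ 2 * gramDet hE h h8 σ := by
  rw [linearForm_eq_mul_hDegree hE h8 δ (cupProduct deg448 σ σ),
    linearForm_eq_mul_hDegree hE h8 δ (cupProduct deg448 (cupPowTwo h 4) (cupPowTwo h 4)),
    linearForm_eq_mul_hDegree hE h8 δ (cupProduct deg448 σ (cupPowTwo h 4)), gramDet_eq]
  ring

/-- **THE GRAM DETECTOR (C5 at the seed, numerical form), under the NAMED Hodge–Riemann positivity hypothesis `hHR`.**
`hHR` (NOT proved here; typed as a hypothesis on the frame, an instance is an obligation): for a polarised anchor and an ample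
`K`-balanced `h`, `W_K ⊗ ℝ ⊆ H⁸(S⁴)` consists of PRIMITIVE real classes of type `(4, 4)` (`W ⟂ h`, van Geemen 5.2), on which the
Hodge–Riemann form `(−1)^{k(k−1)∕2} ∫ α ∪ ᾱ`, `k = 8`, is positive definite — `∫ w ∪ w > 0` for real `w ≠ 0`, the sign of `∫ h⁸`; in the
`h`-normalisation: `Re deg_h(wOf ν ∪ wOf ν) > 0` for every `ν ≠ 0`. CONCLUSION: the C5 class `σ = q·h⁴ + wOf μ` has a NON-ZERO Weil
coordinate iff its Gram determinant against `h⁴` is positive, **`μ ≠ 0 ↔ 0 < Re G_h(σ)`** — three intersection numbers of the seed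
(`Z·Z`, `Z·h⁴`, `h⁸`) decide the design half of C5 AT THE SEED, independently of the frame and of `q`. (The SHAPE `cl(Z) ∈ ℚ·h⁴ ⊕ W_K`
is NOT tested by `G_h`: a class with other `W'`-components can have either sign.)
[cite: VoisinHodgeI2002, Thm. 6.32] [cite: vanGeemen1994HodgeAV, Lemma 5.2] -/
theorem mu_ne_zero_iff_gramDet_pos (hE : E₀.dim = 1) (hψ : ψ₀ ≫ ψ₀ = -(1 • 𝟙 E₀)) (F : WeilFrame E₀ ψ₀) (μ : GaussianInt)
    (q : ℚ) {h : complexBetti (pad4Anchor E₀).X 2}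
    (hh : h ∈ pullbackEigenclasses (pad4Anchor E₀) (pad4Action E₀ ψ₀) 2 (bideg 1 1 1)) (h8 : cupPowTwo h 8 ≠ 0)
    (hHR : ∀ ν : GaussianInt, ν ≠ 0 → 0 < (hDegree hE h h8 (cupProduct deg448 (F.wOf ν) (F.wOf ν))).re) :
    μ ≠ 0 ↔ 0 < (gramDet hE h h8 (((q : ℚ) : ℂ) • cupPowTwo h 4 + F.wOf μ)).re := by
  rw [gramDet_classC5 hE hψ F μ q hh h8]
  constructor
  · exact hHR μ
  · intro hpos hμ
    subst hμ
    have h0 : F.wOf 0 = 0 := by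
      rw [WeilFrame.wOf, Zsqrtd.re_zero, Zsqrtd.im_zero, Int.cast_zero, Rat.cast_zero, zero_smul, zero_smul, add_zero]
    rw [h0] at hpos
    simp only [map_zero, Complex.zero_re] at hpos
    exact lt_irrefl 0 hpos

/-- and then **`deg_h(σ ∪ σ) > q²` iff `μ ≠ 0`** (`deg_h(σ²) = q² + deg_h(wOf μ ∪ wOf μ)`): the self-intersection of a genuine Weil
seed STRICTLY EXCEEDS the square of its `h`-degree. -/
theorem hDegree_sq_lt_self_iff (hE : E₀.dim = 1) (hψ : ψ₀ ≫ ψ₀ = -(1 • 𝟙 E₀)) (F : WeilFrame E₀ ψ₀) (μ : GaussianInt)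
    (q : ℚ) {h : complexBetti (pad4Anchor E₀).X 2}
    (hh : h ∈ pullbackEigenclasses (pad4Anchor E₀) (pad4Action E₀ ψ₀) 2 (bideg 1 1 1)) (h8 : cupPowTwo h 8 ≠ 0)
    (hHR : ∀ ν : GaussianInt, ν ≠ 0 → 0 < (hDegree hE h h8 (cupProduct deg448 (F.wOf ν) (F.wOf ν))).re) :
    μ ≠ 0 ↔ (q : ℝ) ^ 2 <
      (hDegree hE h h8 (cupProduct deg448 (((q : ℚ) : ℂ) • cupPowTwo h 4 + F.wOf μ)
        (((q : ℚ) : ℂ) • cupPowTwo h 4 + F.wOf μ))).re := by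
  rw [mu_ne_zero_iff_gramDet_pos hE hψ F μ q hh h8 hHR, gramDet_classC5 hE hψ F μ q hh h8,
    hDegree_classC5_classC5 hE hψ F μ μ q q hh h8, Complex.add_re]
  have hq : (((q : ℚ) : ℂ) * ((q : ℚ) : ℂ)).re = (q : ℝ) ^ 2 := by
    simp only [Complex.mul_re, Complex.ratCast_re, Complex.ratCast_im, mul_zero, sub_zero]
    ring
  rw [hq]
  constructor
  · intro h
    linarith
  · intro h
    linarith

end GramDetector

end Summit.HodgeConjecture.HodgeConjecture.Cruxes.BlochSeedDiscOne.SeedChecker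

end
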